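import Summits.BirchSwinnertonDyer.Rank1Residual.F1Sign2.KatzFrobeniusColumn
import Summits.BirchSwinnertonDyer.Rank1Residual.Supersingular.TamParityChi8Link
import Summits.BirchSwinnertonDyer.BirchSwinnertonDyer.Theorems.ByReductionTypeAtTwoRankOneNaiveSigmaLogRecursion
import Summits.BirchSwinnertonDyer.BirchSwinnertonDyer.Theorems.ByReductionTypeAtTwoRankOnePerrinRiouElementAtTwo
import Summits.BirchSwinnertonDyer.BirchSwinnertonDyer.Theorems.Rank2ObservatoryKrausMinimality
import HarnessLib

/-!
# Route `ByReductionTypeAtTwo`, crux `RankOneAtTwoBigImageOddLocal` (stmt-BirchSwinnertonDyer-23715), cell `bsd-f1-sign2`,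
# planner seat `-an` g52 (`--supports 23715`, helper): **K2-Φ PROVED — the Katz Frobenius column at a good supersingular `2`
# has `‖v‖₂ = 1/2` and `‖u‖₂ ≤ 1/2`**, from the receptacle rows `n = 1, 2` alone.

THEOREMS ONLY (no definition, no named fact, no `sorry`).

`Summit.BirchSwinnertonDyer.Rank1Residual.F1Sign2.KatzFrobeniusColumnValAtTwo` (K2-Φ, seat `-es` MEMO-es §15; REF1-AUDIT §80:
"THEOREM-GRADE ON PAPER … tree-hard (needs `H¹_cris` … none in the tree today)") is proved here WITHOUT crystalline cohomology:
write the Katz rows of `IsKatzFrobeniusColumn W 2 u v` (`v = c₂⁻¹`, `u = −c₁c₂⁻¹`) at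
* `n = 1`: `‖g₀ − c₁·b₁‖ ≤ 1` with `g₀ = [t²](t²x·ω/dt) = 0`, `b₁ = [t⁰](ω/dt) = 1` ⟹ `c₁ ∈ ℤ₂`;
* `n = 2`: `‖g₁ − c₁·b₂ − 2c₂·b₁‖ ≤ ‖2‖ = 1/2` with `g₁ = [t³](t²x·ω/dt) = a₃`, `b₂ = [t¹](ω/dt) = a₁`.
At a good supersingular `2` the minimal model has `a₁` even and `a₃` odd (tree theorem
`even_a₁_and_odd_a₃_of_goodSS_two`), so `a₃ − c₁a₁ ∈ 1 + 2ℤ₂` is a unit, hence (ultrametric) `2c₂` is a unit: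
`‖c₂‖ = 2`, `‖v‖ = ‖c₂‖⁻¹ = 1/2`, `‖u‖ = ‖c₁‖·‖c₂‖⁻¹ ≤ 1/2`.  (REF1 §80 rider r4 used rows `n = 1, p` for `c₁ ∈ ℤ₂`,
`2c₂ ∈ ℤ₂`; read as a congruence MOD 2 — `‖·‖ ≤ ‖2‖` — row `n = 2` also gives the upper bound `‖v‖ ≤ 1/2`: in the basis
`(ω, η)` it is the statement `φ(ω) ≡ a₃·v·η (mod 2)`, i.e. the Hasse invariant `a₁ ≡ 0` at a supersingular `2`.)  The same two rows give the twin for the `-an` receptacle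
`IsKatzColumnAtTwo` (D51-K of `…PerrinRiouElementAtTwo`): `‖v‖ = 1/2`, `‖u‖ ≤ 1/2` (`isKatzColumnAtTwo_norm`).

Consumers: discharges the hypothesis `hΦ : KatzFrobeniusColumnValAtTwo` of
`Rank1Residual.F1Sign2.twoAdicBSDFomegaValRankOneSs_of_eta` (K2-Vss ⟹ the `F_ω`-normalised law) and the `v ≠ 0`,
`v₂(v) = 1` bookkeeping of the `-an` laws 55A/55B/56A.  Inputs: `Rank2Observatory.padic_norm_two`, `constantCoeff_formalOmega`,
`coeff_one_formalOmega`, `NaiveSigmaLogAtTwo.coeff_two_three_formalOmega_mul_formalXMulSq` (`g₀ = 0`, `g₁ = a₃`).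
[cite: Katz1981CrysCohDieudonne, §5.1, Lemma 5.1.2] [cite: SilvermanAEC2009, IV.1.1]
-/

set_option autoImplicit false
set_option linter.dupNamespace false

noncomputable section

open WeierstrassCurve PowerSeries
open Literature.NumberTheory.EllipticCurves Literature.NumberTheory.EllipticCurves.Rank1Residual
open Summit.BirchSwinnertonDyer.Rank1Residual.F1Sign2
open Summit.BirchSwinnertonDyer.Rank1Residual.Supersingular
open Summit.BirchSwinnertonDyer.BirchSwinnertonDyer (Rank2Observatory.padic_norm_two)

namespace Summit.BirchSwinnertonDyer.BirchSwinnertonDyer.Theorems.PerrinRiouElementAtTwo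

/-! ### §1 Elementary inputs -/

/-- At a good supersingular `2`, on the globally minimal model: `a₁ = 2k` and `a₃ = 2m + 1` for integers `k, m`
(tree theorem `even_a₁_and_odd_a₃_of_goodSS_two` transported through `map_integralModelInt`). [folklore] -/
theorem exists_a₁_a₃_of_goodSS_two (W : WeierstrassCurve ℚ) [W.IsGloballyMinimal]
    (hgood : W.HasGoodReductionAtPrime 2) (hss : (2 : ℤ) ∣ W.frobeniusTrace 2) :
    ∃ k m : ℤ, W.a₁ = (2 * k : ℤ) ∧ W.a₃ = (2 * m + 1 : ℤ) := by
  obtain ⟨⟨k, hk⟩, ⟨m, hm⟩⟩ := even_a₁_and_odd_a₃_of_goodSS_two W hgood hss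
  have hW := map_integralModelInt W
  have h1 : (Int.castRingHom ℚ) (integralModelInt W).a₁ = W.a₁ := by rw [← congrArg WeierstrassCurve.a₁ hW]; rfl
  have h3 : (Int.castRingHom ℚ) (integralModelInt W).a₃ = W.a₃ := by rw [← congrArg WeierstrassCurve.a₃ hW]; rfl
  refine ⟨k, m, ?_, ?_⟩
  · rw [← h1, hk, eq_intCast]; push_cast; ring
  · rw [← h3, hm, eq_intCast]

/-- The ultrametric step: if `‖A‖ = 1` and `‖A - B‖ ≤ 1/2` in `ℚ_[2]` then `‖B‖ = 1`. [folklore] -/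
theorem norm_eq_one_of_norm_sub_le_half {A B : ℚ_[2]} (hA : ‖A‖ = 1) (hAB : ‖A - B‖ ≤ 2⁻¹) : ‖B‖ = 1 := by
  by_contra hB
  have hne : ‖A‖ ≠ ‖-B‖ := by rwa [norm_neg, hA, ne_comm, ne_eq] at *
  have hmax := Padic.add_eq_max_of_ne hne
  rw [← sub_eq_add_neg, norm_neg, hA] at hmax
  have : (1 : ℝ) ≤ ‖A - B‖ := by rw [hmax]; exact le_max_left _ _
  linarith

/-- `‖1 + 2·z‖ = 1` for `‖z‖ ≤ 1` in `ℚ_[2]`. [folklore] -/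
theorem norm_one_add_two_mul {z : ℚ_[2]} (hz : ‖z‖ ≤ 1) : ‖1 + 2 * z‖ = 1 := by
  have h2z : ‖(2 : ℚ_[2]) * z‖ ≤ 2⁻¹ := by
    rw [norm_mul, Rank2Observatory.padic_norm_two]
    calc (2 : ℝ)⁻¹ * ‖z‖ ≤ 2⁻¹ * 1 := by gcongr
      _ = 2⁻¹ := by ring
  have hne : ‖(1 : ℚ_[2])‖ ≠ ‖(2 : ℚ_[2]) * z‖ := by
    rw [norm_one]; intro h; rw [← h] at h2z; norm_num at h2z
  rw [Padic.add_eq_max_of_ne hne, norm_one, max_eq_left (le_trans h2z (by norm_num))]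

/-! ### §2 The two Katz rows -/

/-- **Rows `n = 1, 2` of the Katz receptacle, evaluated**: for `W/ℚ` and `c₁ c₂ : ℚ_[2]` satisfying the rows of
`IsKatzFrobeniusColumn W 2` one has `‖c₁‖ ≤ 1` and `‖a₃ − c₁·a₁ − 2·c₂‖ ≤ 1/2`.
[cite: Katz1981CrysCohDieudonne, §5.1] -/
theorem katzRows_one_two (W : WeierstrassCurve ℚ) (c₁ c₂ : ℚ_[2])
    (hrows : ∀ n : ℕ, 0 < n →
      ‖((coeff (n + 1) (W.formalXMulSq * W.formalOmega) : ℚ) : ℚ_[2])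
          - c₁ * ((coeff (n - 1) W.formalOmega : ℚ) : ℚ_[2])
          - (if 2 ∣ n then ((2 : ℕ) : ℚ_[2]) * c₂ * ((coeff (n / 2 - 1) W.formalOmega : ℚ) : ℚ_[2]) else 0)‖
        ≤ ‖(n : ℚ_[2])‖) :
    ‖c₁‖ ≤ 1 ∧ ‖((W.a₃ : ℚ) : ℚ_[2]) - c₁ * ((W.a₁ : ℚ) : ℚ_[2]) - 2 * c₂‖ ≤ 2⁻¹ := by
  obtain ⟨hg0, hg1⟩ := NaiveSigmaLogAtTwo.coeff_two_three_formalOmega_mul_formalXMulSq W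
  have hω0 : coeff 0 W.formalOmega = 1 := by rw [coeff_zero_eq_constantCoeff]; exact W.constantCoeff_formalOmega
  have hω1 : coeff 1 W.formalOmega = W.a₁ :=
    Literature.NumberTheory.EllipticCurves.DescendedFrobenius.FormalGroupCoefficients.coeff_one_formalOmega W
  have h1 := hrows 1 one_pos
  have h2 := hrows 2 two_pos
  have hnd : ¬ (2 ∣ 1) := by decide
  rw [mul_comm W.formalXMulSq] at h1 h2
  simp only [Nat.reduceAdd, hg0, Rat.cast_zero, Nat.sub_self, hω0, Rat.cast_one, mul_one, if_neg hnd, sub_zero,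
    zero_sub, norm_neg, Nat.cast_one, norm_one] at h1
  have h22 : (2 : ℕ) / 2 - 1 = 0 := by decide
  simp only [Nat.reduceAdd, hg1, show (2 : ℕ) - 1 = 1 from rfl, hω1, if_pos (dvd_refl 2), h22, hω0, Rat.cast_one,
    mul_one, Nat.cast_ofNat, Rank2Observatory.padic_norm_two] at h2
  exact ⟨h1, h2⟩

/-- **The unit step**: at a good supersingular `2`, rows `n = 1, 2` force `‖2·c₂‖ = 1`. [folklore] -/
theorem norm_two_mul_c₂_eq_one (W : WeierstrassCurve ℚ) [W.IsGloballyMinimal]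
    (hgood : W.HasGoodReductionAtPrime 2) (hss : (2 : ℤ) ∣ W.frobeniusTrace 2) {c₁ c₂ : ℚ_[2]}
    (hc₁ : ‖c₁‖ ≤ 1) (h2 : ‖((W.a₃ : ℚ) : ℚ_[2]) - c₁ * ((W.a₁ : ℚ) : ℚ_[2]) - 2 * c₂‖ ≤ 2⁻¹) :
    ‖(2 : ℚ_[2]) * c₂‖ = 1 := by
  obtain ⟨k, m, hk, hm⟩ := exists_a₁_a₃_of_goodSS_two W hgood hss
  rw [hk, hm] at h2
  push_cast at h2
  have hA : ‖(2 * (m : ℚ_[2]) + 1) - c₁ * (2 * (k : ℚ_[2]))‖ = 1 := by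
    have : (2 * (m : ℚ_[2]) + 1) - c₁ * (2 * (k : ℚ_[2])) = 1 + 2 * ((m : ℚ_[2]) - c₁ * k) := by ring
    rw [this]
    apply norm_one_add_two_mul
    calc ‖(m : ℚ_[2]) - c₁ * k‖ = ‖(m : ℚ_[2]) + -(c₁ * k)‖ := by rw [sub_eq_add_neg]
      _ ≤ max ‖(m : ℚ_[2])‖ ‖-(c₁ * (k : ℚ_[2]))‖ := Padic.nonarchimedean _ _
      _ = max ‖(m : ℚ_[2])‖ ‖c₁ * (k : ℚ_[2])‖ := by rw [norm_neg]
      _ ≤ 1 := by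
        refine max_le (Padic.norm_int_le_one m) ?_
        rw [norm_mul]
        calc ‖c₁‖ * ‖(k : ℚ_[2])‖ ≤ 1 * 1 := by
              gcongr
              exact Padic.norm_int_le_one k
          _ = 1 := one_mul 1
  exact norm_eq_one_of_norm_sub_le_half hA h2

/-! ### §3 K2-Φ and its `-an` twin -/

/-- **K2-Φ PROVED.** `Rank1Residual.F1Sign2.KatzFrobeniusColumnValAtTwo`: at a good supersingular prime `2` of a globally
minimal `W/ℚ`, every Katz Frobenius column `(u, v)` has `‖v‖₂ = 1/2` and `‖u‖₂ ≤ 1/2`.  Proof: rows `n = 1, 2` of the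
receptacle + `a₁` even, `a₃` odd (module docstring).
[cite: Katz1981CrysCohDieudonne, §5.1, Thm 5.1.5] [cite: Mazur1972FrobeniusHodge, Thm. 1] -/
theorem katzFrobeniusColumnValAtTwo_holds : KatzFrobeniusColumnValAtTwo := by
  intro W _ _ hgood hnord u v hK
  have hss : (2 : ℤ) ∣ W.frobeniusTrace 2 := by
    by_contra h
    exact hnord ((isOrdinaryAt_iff W 2).mpr ⟨hgood, h⟩)
  obtain ⟨c₁, c₂, hc₂, hv, hu, hrows⟩ := hK
  obtain ⟨hc₁, h2⟩ := katzRows_one_two W c₁ c₂ hrows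
  have hunit := norm_two_mul_c₂_eq_one W hgood hss hc₁ h2
  rw [norm_mul, Rank2Observatory.padic_norm_two] at hunit
  have hc₂n : ‖c₂‖ = 2 := by
    have : ‖c₂‖ = 2 * (2⁻¹ * ‖c₂‖) := by ring
    rw [this, hunit]; norm_num
  refine ⟨?_, ?_⟩
  · rw [hv, norm_inv, hc₂n]
  · rw [hu, norm_mul, norm_neg, norm_inv, hc₂n]
    calc ‖c₁‖ * (2 : ℝ)⁻¹ ≤ 1 * 2⁻¹ := by gcongr
      _ = 2⁻¹ := one_mul _

/-- **K2-Φ for the `-an` receptacle `IsKatzColumnAtTwo`** (D51-K; rows written with `u/v = −c₁`, `2/v = 2c₂` over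
`W ⊗ ℚ₂`): at a good supersingular `2`, `‖v‖₂ = 1/2` and `‖u‖₂ ≤ 1/2`. Same proof.
[cite: Katz1981CrysCohDieudonne, §5.1] -/
theorem isKatzColumnAtTwo_norm (W : WeierstrassCurve ℚ) [W.IsGloballyMinimal]
    (hgood : W.HasGoodReductionAtPrime 2) (hss : (2 : ℤ) ∣ W.frobeniusTrace 2) {u v : ℚ_[2]}
    (huv : IsKatzColumnAtTwo W u v) : ‖v‖ = 2⁻¹ ∧ ‖u‖ ≤ 2⁻¹ := by
  obtain ⟨hv0, hrows⟩ := huv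
  set W₂ : WeierstrassCurve ℚ_[2] := W.map (algebraMap ℚ ℚ_[2]) with hW₂
  obtain ⟨hg0, hg1⟩ := NaiveSigmaLogAtTwo.coeff_two_three_formalOmega_mul_formalXMulSq W₂
  have hω0 : coeff 0 W₂.formalOmega = 1 := by rw [coeff_zero_eq_constantCoeff]; exact W₂.constantCoeff_formalOmega
  have hω1 : coeff 1 W₂.formalOmega = W₂.a₁ :=
    Literature.NumberTheory.EllipticCurves.DescendedFrobenius.FormalGroupCoefficients.coeff_one_formalOmega W₂
  have ha1 : W₂.a₁ = ((W.a₁ : ℚ) : ℚ_[2]) := by simp [hW₂]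
  have ha3 : W₂.a₃ = ((W.a₃ : ℚ) : ℚ_[2]) := by simp [hW₂]
  have h1 := hrows 1 le_rfl
  have h2 := hrows 2 one_le_two
  have hnd : ¬ (2 ∣ 1) := by decide
  have h22 : (2 : ℕ) / 2 - 1 = 0 := by decide
  simp only [Nat.reduceAdd, hg0, Nat.sub_self, hω0, mul_one, if_neg hnd, mul_zero, sub_zero, zero_add,
    Nat.cast_one, div_one] at h1
  simp only [Nat.reduceAdd, hg1, ha3, show (2 : ℕ) - 1 = 1 from rfl, hω1, ha1, if_pos (dvd_refl 2), h22, hω0,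
    mul_one, Nat.cast_ofNat, norm_div, Rank2Observatory.padic_norm_two] at h2
  -- h1 : ‖u / v‖ ≤ 1 ;  h2 : ‖a₃ + u/v * a₁ - 2/v‖ / 2⁻¹ ≤ 1
  have h2' : ‖((W.a₃ : ℚ) : ℚ_[2]) - (-(u / v)) * ((W.a₁ : ℚ) : ℚ_[2]) - 2 * v⁻¹‖ ≤ 2⁻¹ := by
    rw [div_le_one (by norm_num)] at h2
    have : ((W.a₃ : ℚ) : ℚ_[2]) - (-(u / v)) * ((W.a₁ : ℚ) : ℚ_[2]) - 2 * v⁻¹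
        = ((W.a₃ : ℚ) : ℚ_[2]) + u / v * ((W.a₁ : ℚ) : ℚ_[2]) - 2 / v := by ring
    rwa [this]
  have hc₁ : ‖-(u / v)‖ ≤ 1 := by rwa [norm_neg]
  have hunit := norm_two_mul_c₂_eq_one W hgood hss hc₁ h2'
  rw [norm_mul, Rank2Observatory.padic_norm_two, norm_inv] at hunit
  have hvn : ‖v‖ = 2⁻¹ := by
    have hv' : ‖v‖ ≠ 0 := norm_ne_zero_iff.mpr hv0
    field_simp at hunit
    linarith
  refine ⟨hvn, ?_⟩
  have : u = (u / v) * v := by field_simp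
  rw [this, norm_mul, hvn]
  calc ‖u / v‖ * (2 : ℝ)⁻¹ ≤ 1 * 2⁻¹ := by gcongr
    _ = 2⁻¹ := one_mul _

end Summit.BirchSwinnertonDyer.BirchSwinnertonDyer.Theorems.PerrinRiouElementAtTwo

end
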